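import Literature.NumberTheory.LFunctions.TruncatedWeilFormTestFunctionProofs
import Literature.NumberTheory.LFunctions.TruncatedWeilFormTailOrderDensityProofs
import Literature.NumberTheory.LFunctions.TruncatedWeilFormArchTailProofs
import HarnessLib

/-!
# RH-FREE — «nothing here bears on the truth of RH»: the ARCHIMEDEAN side of Groskin's finite
# Guinand–Weil dictionary (arXiv:2607.02828v3, Theorem 2.5, proof p. 6, third display) at finite `T`,
# the dominated-convergence step `T → ∞`, and the DISCHARGE `theorem_2_5'_holds` of the
# explicit-formula side `theorem_2_5'`

Topic `Literature/NumberTheory/LFunctions` (namespace `Literature.NumberTheory.LFunctions.Groskin2026`).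
Proofs only (no named facts, no `def`s), over the statement file `TruncatedWeilFormTailOrder.lean`
(rh-lit-frontier-1, p461241).  Cell rh-crit (cc-t9 g4; ledger claim `Groskin2026.theorem_2_5'`):
stages (A) and (D) of the discharge of `theorem_2_5'`; stages (P) prime side and (Q) pole side are
`TruncatedWeilFormSourceSideProofs.lean` (p469516).  Consumed BY NAME: cc-t4 g5's `lemma_2_2_holds`
machinery (`testFunction_eq_two_integrals`, `norm_testFunction_le_strip`, `differentiable_testFunction`,
file `TruncatedWeilFormTestFunctionProofs.lean`), cc-t6 g5's `h₊` toolkit (`hPlus_le_log_sub`, file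
`TruncatedWeilFormTailOrderDensityProofs.lean`), cc-t11 g4's `lemma_2_1_limit_holds` (Lemma 2.1, limit
clause; file `TruncatedWeilFormArchTailProofs.lean`), the statement file's `hPlus_pos_of_seven_le`, and
the tree's `continuous_reDigammaQuarter` / `reDigammaQuarter_even`.  Lemma 2.1's limit clause enters
through the door `theorem_2_5'_of (h21 : lemma_2_1_limit)` and is fed by name in `theorem_2_5'_holds`.

Source: A. Groskin, arXiv:2607.02828v3 (UNREFEREED, D-0012: `[claim: Groskin2026, status:
under-review]`; a kernel proof VERIFIES the identities below, it asserts nothing on authority), proof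
of Theorem 2.5, p. 6 (materialised text `paper:arxiv-2607.02828` p0006.txt:L62–L79, OPENED): «Applied
inside the compact finite-T archimedean integral,
`⟨v, Q_arch,T v⟩ = (1/2π)∫_{−T}^{T} h₊(r) (∫₀^L K_v(1 − y/L) cos(ry) dy) dr = (1/2π)∫_{−T}^{T} h₊(r) g_v(r) dr`,
where the inner integral is `g_v(r)` by the same substitution `ξ = Δ(1 − y/L)` and evenness of `ĝ_v`.
Lemma 2.2 and `h₊(r) = O(log(2 + |r|))` [24] allow `T → ∞` by dominated convergence. Thus the
assembly (4) equals the displayed prime, pole, and archimedean source expression.»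

LINE 1 — LABEL: **RH-FREE** (Fourier calculus at fixed `(c, N)` plus one dominated-convergence
limit; `ζ` and its zeros do not occur — the ZERO side `theorem_2_5`, i.e. the explicit formula, is
not touched).  bears_on: W-C/W-P (LADDER-RH COLUMN 2, the finite Guinand–Weil dictionary's source
side).  WHAT THIS IS NOT: not Weil positivity, not a statement about zeros, not progress toward RH —
«the paper does not prove RH, Weil positivity, a prime-location bound» (its p. 13); nothing in this file
bears on the truth of the Riemann hypothesis.

## Contents (source item → declaration → status)

* `g_v` on `[0, L]` for every complex argument: `cos_integrand_eq`, **`testFunction_eq_integral_cos`**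
  (`g_v(z) = ∫₀^L K_v(1 − y/L) cos(zy) dy`; evenness fold = t4 g5's `testFunction_eq_two_integrals`,
  then `ξ = y/2π`). PROVED.
* (A) archimedean side at finite `T`: `archSource_eq_sinIntegral` (Fubini: `ψ_{R,T}` is the
  superposition `∫₀^L a_T(y) sin(2π(1 − y/L)x) dy`, `a_T(y) = (1/2π²)∫_{−T}^{T} h₊(r)cos(ry) dr`),
  `quadValue_archMatrix_eq_integral` (the engine `quadValue_dividedDiffMatrix_sinIntegral` of the
  source-side file), and **`quadValue_archMatrix`**:
  `⟨v, Q_arch,T v⟩ = (1/2π)∫_{−T}^{T} h₊(r) g_v(r) dr` (Fubini again). PROVED, every real `T`.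
* (D) `T → ∞`: `exists_abs_hPlus_le_log` (`|h₊(r)| ≤ A + log(2 + |r|)`, the printed `O(log(2 + |r|))`),
  `integrable_hPlus_mul_testFunction` (with Lemma 2.2's `(1 + |r|)⁻²` decay: majorant
  `(1 + |r|)^{−3/2}`), `tendsto_quadValue_archMatrix`
  (`⟨v, Q_arch,T v⟩ → (1/2π)∫_ℝ h₊ g_v`), `quadValue_add`, `tendsto_quadValue_archMatrix_of_limit` and
  `quadValue_archMatrixInfty_of_limit` (under `lemma_2_1_limit`: `⟨v, Q_arch,∞ v⟩ = (1/2π)∫_ℝ h₊ g_v`),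
  the door **`theorem_2_5'_of (h21 : lemma_2_1_limit) : theorem_2_5'`**, and the DISCHARGE
  **`theorem_2_5'_holds : theorem_2_5'`** (`:= theorem_2_5'_of lemma_2_1_limit_holds`). PROVED.

## Proof route and divergences

As printed.  The statement file DEFINES `Q_arch,∞` by `limUnder`, so identifying `⟨v, Q_arch,∞ v⟩`
with the limit of `⟨v, Q_arch,T v⟩` needs every ENTRY to converge (the even-sector quadratic forms
alone see only `Q_{mn} + Q_{m,−n}`): this is Lemma 2.1's first clause, kept as the explicit
hypothesis `h21` of the door and fed by cc-t11 g4's `lemma_2_1_limit_holds`.  The growth input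
`h₊ = O(log(2 + |r|))`, cited to [24] (Titchmarsh) in the source, is proved here from the tree
(`hPlus_le_log_sub` beyond `7`, continuity on `[−7, 7]`).

## References

* A. Groskin, arXiv:2607.02828v3 (2026), §2.1 eq. (3) p. 3, Lemma 2.1 p. 4, Lemma 2.2 p. 4,
  Theorem 2.5 and its proof p. 6 (third display and the `T → ∞` sentence).
-/

noncomputable section

open Filter Set MeasureTheory Complex Finset Matrix
open scoped Real Topology

namespace Literature.NumberTheory.LFunctions

namespace Groskin2026

open Literature.Analysis.SpecialFunctions

/-! ### Two tools -/

/-- Fubini for interval integrals of a jointly continuous integrand (Mathlib's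
`intervalIntegral_intervalIntegral_swap`, integrability from continuity on the compact rectangle).
[folklore] -/
private theorem intervalIntegral_swap_of_continuous {E : Type*} [NormedAddCommGroup E]
    [NormedSpace ℝ E] {F : ℝ → ℝ → E} (hF : Continuous (Function.uncurry F)) (a b c d : ℝ) :
    ∫ x in a..b, ∫ y in c..d, F x y = ∫ y in c..d, ∫ x in a..b, F x y :=
  MeasureTheory.intervalIntegral_intervalIntegral_swap
    ((hF.continuousOn.integrableOn_compact (isCompact_uIcc.prod isCompact_uIcc)).mono_set
      (Set.prod_mono Set.uIoc_subset_uIcc Set.uIoc_subset_uIcc))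

/-- `h₊` is continuous (the tree's `continuous_reDigammaQuarter`). [folklore] -/
private theorem hPlus_continuous : Continuous hPlus := by
  unfold hPlus
  exact continuous_reDigammaQuarter.sub continuous_const

/-! ### `g_v(z) = ∫₀^L K_v(1 − y/L) cos(zy) dy` -/

/-- The rescaled integrand: `(2π)⁻¹ · (πK_v(1 − (y/2π)/Δ) e^{−2πiz·y/2π} + πK_v(…) e^{2πiz·y/2π})
= K_v(1 − y/L) cos(zy)` (`Δ = L/2π`). [cite: Groskin2026, Theorem 2.5 proof (p. 6)] -/
theorem cos_integrand_eq {c : ℝ} (N : ℕ) (v : Fin (N + 1) → ℝ) (z : ℂ) (y : ℝ) :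
    (((2 * π)⁻¹ : ℝ) : ℂ) *
        ((π * volterraKernel N v (1 - y / (2 * π) / bandwidth c)) *
            cexp (-(2 * π * I * z) * (y / (2 * π) : ℝ)) +
          (π * volterraKernel N v (1 - y / (2 * π) / bandwidth c)) *
            cexp ((2 * π * I * z) * (y / (2 * π) : ℝ))) =
      volterraKernel N v (1 - y / Real.log c) * Complex.cos (z * y) := by
  have hπ : (π : ℝ) ≠ 0 := Real.pi_ne_zero
  have hπC : (π : ℂ) ≠ 0 := Complex.ofReal_ne_zero.2 hπ
  have h1 : y / (2 * π) / bandwidth c = y / Real.log c := by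
    rw [bandwidth]
    field_simp
  have h2 : (2 * π * I * z) * ((y / (2 * π) : ℝ) : ℂ) = z * y * I := by
    push_cast
    field_simp
  have h3 : -(2 * π * I * z) * ((y / (2 * π) : ℝ) : ℂ) = -(z * y) * I := by
    rw [neg_mul, h2]; ring
  rw [h1, h2, h3, Complex.cos]
  push_cast
  field_simp
  ring

/-- **`g_v(z) = ∫₀^L K_v(1 − y/L) cos(zy) dy` for every complex `z`** (the substitution
`ξ = Δ(1 − y/L)` and evenness of `ĝ_v`). [cite: Groskin2026, Theorem 2.5 proof (p. 6)] -/
theorem testFunction_eq_integral_cos {c : ℝ} (hc : 1 < c) (N : ℕ) (v : Fin (N + 1) → ℝ) (z : ℂ) :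
    testFunction c N v z =
      ∫ y in (0 : ℝ)..Real.log c, volterraKernel N v (1 - y / Real.log c) * Complex.cos (z * y) := by
  have h2π : (2 * π : ℝ) ≠ 0 := by positivity
  set F : ℝ → ℂ := fun ξ ↦
    (π * volterraKernel N v (1 - ξ / bandwidth c)) * cexp (-(2 * π * I * z) * ξ) +
      (π * volterraKernel N v (1 - ξ / bandwidth c)) * cexp ((2 * π * I * z) * ξ) with hF
  have hK : Continuous fun ξ : ℝ ↦ (π : ℂ) * volterraKernel N v (1 - ξ / bandwidth c) :=
    continuous_const.mul ((continuous_volterraKernel N v).comp (by fun_prop))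
  have hi1 : IntervalIntegrable (fun ξ : ℝ ↦ (π * volterraKernel N v (1 - ξ / bandwidth c)) *
      cexp (-(2 * π * I * z) * ξ)) volume 0 (bandwidth c) :=
    (hK.mul (Complex.continuous_exp.comp (by fun_prop))).intervalIntegrable _ _
  have hi2 : IntervalIntegrable (fun ξ : ℝ ↦ (π * volterraKernel N v (1 - ξ / bandwidth c)) *
      cexp ((2 * π * I * z) * ξ)) volume 0 (bandwidth c) :=
    (hK.mul (Complex.continuous_exp.comp (by fun_prop))).intervalIntegrable _ _
  -- fold onto `[0, Δ]`
  have h1 : testFunction c N v z = ∫ ξ in (0 : ℝ)..bandwidth c, F ξ := by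
    rw [testFunction_eq_two_integrals hc N v z, ← intervalIntegral.integral_add hi1 hi2]
  -- substitution `ξ = y/(2π)`
  have h3 : ∫ ξ in (0 : ℝ)..bandwidth c, F ξ =
      ((2 * π)⁻¹ : ℝ) * ∫ y in (0 : ℝ)..Real.log c, F (y / (2 * π)) := by
    have key := intervalIntegral.integral_comp_mul_left (a := 0) (b := Real.log c) F
      (inv_ne_zero h2π)
    have hb : (2 * π)⁻¹ * Real.log c = bandwidth c := by rw [bandwidth]; field_simp
    rw [mul_zero, hb, inv_inv, Complex.real_smul] at key
    have hFdiv : (fun y : ℝ ↦ F (y / (2 * π))) = fun y ↦ F ((2 * π)⁻¹ * y) := by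
      funext y; rw [div_eq_inv_mul]
    rw [hFdiv, key, ← mul_assoc]
    have : (((2 * π)⁻¹ : ℝ) : ℂ) * ((2 * π : ℝ) : ℂ) = 1 := by
      rw [← Complex.ofReal_mul, inv_mul_cancel₀ h2π]; simp
    rw [this, one_mul]
  rw [h1, h3, ← intervalIntegral.integral_const_mul]
  refine intervalIntegral.integral_congr fun y _ ↦ ?_
  simp only [hF]
  exact cos_integrand_eq N v z y

/-! ### Stage (A): the archimedean side at finite `T` -/

/-- The finite-`T` archimedean source (3) is the superposition
`ψ_{R,T}(x) = ∫₀^L a_T(y) sin(2π(1 − y/L)x) dy`, `a_T(y) = (1/2π²)∫_{−T}^{T} h₊(r) cos(ry) dr`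
(Fubini on `[−T, T] × [0, L]`). [cite: Groskin2026, §2.1 eq. (3) (p. 3); Theorem 2.5 proof (p. 6)] -/
theorem archSource_eq_sinIntegral {c : ℝ} (T : ℝ) :
    archSource c T = fun x ↦ ∫ y in (0 : ℝ)..Real.log c,
      ((1 / (2 * π ^ 2)) * ∫ r in (-T)..T, hPlus r * Real.cos (r * y)) *
        Real.sin (2 * π * (1 - y / Real.log c) * x) := by
  funext x
  have hcont : Continuous (Function.uncurry fun (r y : ℝ) ↦
      hPlus r * Real.cos (r * y) * Real.sin (2 * π * (1 - y / Real.log c) * x)) :=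
    ((hPlus_continuous.comp continuous_fst).mul (by fun_prop)).mul (by fun_prop)
  have hswap := intervalIntegral_swap_of_continuous hcont (-T) T 0 (Real.log c)
  have hS : ∀ r : ℝ, hPlus r * archKernelS c r x =
      ∫ y in (0 : ℝ)..Real.log c,
        hPlus r * Real.cos (r * y) * Real.sin (2 * π * (1 - y / Real.log c) * x) := by
    intro r
    rw [archKernelS, ← intervalIntegral.integral_const_mul]
    refine intervalIntegral.integral_congr fun y _ ↦ ?_
    rw [show 2 * π * x * (1 - y / Real.log c) = 2 * π * (1 - y / Real.log c) * x by ring]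
    ring
  rw [archSource]
  simp_rw [hS]
  rw [hswap, ← intervalIntegral.integral_const_mul]
  refine intervalIntegral.integral_congr fun y _ ↦ ?_
  rw [intervalIntegral.integral_mul_const]
  ring

/-- `⟨v, Q_arch,T v⟩ = ∫₀^L π a_T(y) K_v(1 − y/L) dy` (the source-side engine
`quadValue_dividedDiffMatrix_sinIntegral` applied to `ψ_{R,T}`).
[cite: Groskin2026, Theorem 2.5 proof (p. 6), third display] -/
theorem quadValue_archMatrix_eq_integral {c : ℝ} (hc : 1 < c) (N : ℕ) (v : Fin (N + 1) → ℝ)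
    (T : ℝ) :
    ((quadValue N v (archMatrix c N T) : ℝ) : ℂ) =
      ∫ y in (0 : ℝ)..Real.log c,
        ((π * ((1 / (2 * π ^ 2)) * ∫ r in (-T)..T, hPlus r * Real.cos (r * y)) : ℝ) : ℂ) *
          volterraKernel N v (1 - y / Real.log c) := by
  have ha : Continuous fun y : ℝ ↦
      (1 / (2 * π ^ 2)) * ∫ r in (-T)..T, hPlus r * Real.cos (r * y) := by
    refine continuous_const.mul ?_
    have h : Continuous (Function.uncurry fun (y r : ℝ) ↦ hPlus r * Real.cos (r * y)) :=
      (hPlus_continuous.comp continuous_snd).mul (by fun_prop)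
    exact intervalIntegral.continuous_parametric_intervalIntegral_of_continuous' h (-T) T
  rw [archMatrix, archSource_eq_sinIntegral T]
  exact quadValue_dividedDiffMatrix_sinIntegral (Real.log_pos hc) ha N v

/-- **Stage (A), the archimedean side of Theorem 2.5 at finite `T`:
`⟨v, Q_arch,T v⟩ = (1/2π)∫_{−T}^{T} h₊(r) g_v(r) dr`** (every real `T`).
[cite: Groskin2026, Theorem 2.5 proof (p. 6), third display] -/
theorem quadValue_archMatrix {c : ℝ} (hc : 1 < c) (N : ℕ) (v : Fin (N + 1) → ℝ) (T : ℝ) :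
    ((quadValue N v (archMatrix c N T) : ℝ) : ℂ) =
      (1 / (2 * π)) * ∫ r in (-T)..T, (hPlus r : ℂ) * testFunction c N v r := by
  have hπ : (π : ℝ) ≠ 0 := Real.pi_ne_zero
  rw [quadValue_archMatrix_eq_integral hc N v T]
  -- pointwise form of the `y`-integrand
  have hpt : ∀ y : ℝ,
      ((π * ((1 / (2 * π ^ 2)) * ∫ r in (-T)..T, hPlus r * Real.cos (r * y)) : ℝ) : ℂ) *
          volterraKernel N v (1 - y / Real.log c) =
        (1 / (2 * π) : ℂ) * ∫ r in (-T)..T,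
          (hPlus r : ℂ) * (volterraKernel N v (1 - y / Real.log c) * Complex.cos (r * y)) := by
    intro y
    have hsc : π * ((1 / (2 * π ^ 2)) * ∫ r in (-T)..T, hPlus r * Real.cos (r * y)) =
        (1 / (2 * π)) * ∫ r in (-T)..T, hPlus r * Real.cos (r * y) := by
      rw [← mul_assoc]
      congr 1
      field_simp
    rw [hsc, Complex.ofReal_mul, ← intervalIntegral.integral_ofReal, mul_assoc,
      ← intervalIntegral.integral_mul_const]
    congr 1
    · push_cast
      ring
    · refine intervalIntegral.integral_congr fun r _ ↦ ?_
      push_cast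
      ring
  simp_rw [hpt]
  rw [intervalIntegral.integral_const_mul]
  congr 1
  have hcont : Continuous (Function.uncurry fun (y r : ℝ) ↦
      (hPlus r : ℂ) * (volterraKernel N v (1 - y / Real.log c) * Complex.cos (r * y))) :=
    (Complex.continuous_ofReal.comp (hPlus_continuous.comp continuous_snd)).mul
      (((continuous_volterraKernel N v).comp (by fun_prop)).mul (by fun_prop))
  rw [intervalIntegral_swap_of_continuous hcont 0 (Real.log c) (-T) T]
  refine intervalIntegral.integral_congr fun r _ ↦ ?_
  rw [intervalIntegral.integral_const_mul, testFunction_eq_integral_cos hc N v r]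

/-! ### Stage (D): `T → ∞` -/

/-- **`h₊(r) = O(log(2 + |r|))`**, here as `|h₊(r)| ≤ A + log(2 + |r|)` with `A ≥ 0` (beyond `|r| = 7`
from `0 < h₊(|r|) ≤ log|r| − 8/5`, t6 g5's `hPlus_le_log_sub` and the statement file's
`hPlus_pos_of_seven_le`, by evenness; on `[−7, 7]` by continuity). The source cites [24] for it.
[cite: Groskin2026, Theorem 2.5 proof (p. 6)] -/
theorem exists_abs_hPlus_le_log : ∃ A : ℝ, 0 ≤ A ∧ ∀ r : ℝ, |hPlus r| ≤ A + Real.log (2 + |r|) := by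
  obtain ⟨M, hM⟩ := (isCompact_Icc (a := (-7 : ℝ)) (b := 7)).exists_bound_of_continuousOn
    hPlus_continuous.continuousOn
  refine ⟨max M 0, le_max_right _ _, fun r ↦ ?_⟩
  have hlog : 0 ≤ Real.log (2 + |r|) := Real.log_nonneg (by linarith [abs_nonneg r])
  rcases le_or_gt 7 |r| with h7 | h7
  · have heven : hPlus r = hPlus |r| := by
      rcases le_or_gt 0 r with h | h
      · rw [abs_of_nonneg h]
      · rw [abs_of_neg h]
        unfold hPlus
        rw [reDigammaQuarter_even]
    have h1 : hPlus |r| ≤ Real.log |r| - 8 / 5 := hPlus_le_log_sub h7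
    have h2 : 0 < hPlus |r| := hPlus_pos_of_seven_le h7
    have h3 : Real.log |r| ≤ Real.log (2 + |r|) := Real.log_le_log (by linarith) (by linarith)
    rw [heven, abs_of_pos h2]
    linarith [le_max_right M 0]
  · have hr : r ∈ Set.Icc (-7 : ℝ) 7 := ⟨by linarith [neg_abs_le r], by linarith [le_abs_self r]⟩
    have := hM r hr
    rw [Real.norm_eq_abs] at this
    linarith [le_max_left M 0]

/-- **`r ↦ h₊(r) g_v(r)` is integrable on `ℝ`** (`h₊ = O(log(2 + |r|))` and Lemma 2.2's
`g_v(r) = O((1 + |r|)⁻²)` = cc-t4 g5's `norm_testFunction_le_strip`; majorant `(1 + |r|)^{−3/2}`).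
[cite: Groskin2026, Theorem 2.5 proof (p. 6), "allow T → ∞ by dominated convergence"] -/
theorem integrable_hPlus_mul_testFunction {c : ℝ} (hc : 1 < c) (N : ℕ) (v : Fin (N + 1) → ℝ) :
    Integrable fun r : ℝ ↦ (hPlus r : ℂ) * testFunction c N v r := by
  obtain ⟨A, hA0, hA⟩ := exists_abs_hPlus_le_log
  obtain ⟨C, hC⟩ := norm_testFunction_le_strip hc N v 0
  have hC0 : 0 ≤ C := by
    have h := hC 0 (by simp)
    simp only [Complex.zero_re, abs_zero, add_zero, one_pow, div_one] at h
    exact (norm_nonneg _).trans h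
  -- the majorant `√(1 + |r|)/(1 + |r|)² = (1 + |r|)^{−3/2}` is integrable
  have hmaj : Integrable fun r : ℝ ↦ Real.sqrt (1 + |r|) / (1 + |r|) ^ 2 := by
    have h := integrable_one_add_norm (E := ℝ) (μ := volume) (r := 3 / 2)
      (by rw [Module.finrank_self]; norm_num)
    refine h.congr (ae_of_all _ fun r ↦ ?_)
    have hu : 0 < 1 + |r| := by positivity
    show (1 + ‖r‖) ^ (-(3 / 2 : ℝ)) = Real.sqrt (1 + |r|) / (1 + |r|) ^ 2
    rw [Real.norm_eq_abs, Real.sqrt_eq_rpow, ← Real.rpow_natCast (1 + |r|) 2, ← Real.rpow_sub hu]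
    congr 1
    norm_num
  refine Integrable.mono' (hmaj.const_mul (C * (A + 2 * Real.sqrt 2))) ?_ (ae_of_all _ fun r ↦ ?_)
  · exact ((Complex.continuous_ofReal.comp hPlus_continuous).mul
      ((differentiable_testFunction hc N v).continuous.comp
        Complex.continuous_ofReal)).aestronglyMeasurable
  · rw [norm_mul, Complex.norm_real, Real.norm_eq_abs]
    have hg := hC r (by simp)
    simp only [Complex.ofReal_re] at hg
    have hh := hA r
    have hu1 : 1 ≤ 1 + |r| := by linarith [abs_nonneg r]
    have hu0 : 0 < 1 + |r| := by linarith
    have hs1 : 1 ≤ Real.sqrt (1 + |r|) := by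
      have h := Real.sqrt_le_sqrt hu1
      rwa [Real.sqrt_one] at h
    -- `log(2 + |r|) ≤ 2√(2 + |r|) ≤ 2√2 · √(1 + |r|)`
    have hlog : Real.log (2 + |r|) ≤ 2 * Real.sqrt 2 * Real.sqrt (1 + |r|) := by
      have h2r : 0 < 2 + |r| := by positivity
      have hl1 : Real.log (2 + |r|) ≤ 2 * Real.sqrt (2 + |r|) := by
        have h := Real.log_le_sub_one_of_pos (Real.sqrt_pos.2 h2r)
        rw [Real.log_sqrt h2r.le] at h
        linarith [Real.sqrt_nonneg (2 + |r|)]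
      have hl2 : Real.sqrt (2 + |r|) ≤ Real.sqrt 2 * Real.sqrt (1 + |r|) := by
        rw [← Real.sqrt_mul (by norm_num : (0 : ℝ) ≤ 2)]
        exact Real.sqrt_le_sqrt (by linarith [abs_nonneg r])
      nlinarith [Real.sqrt_nonneg 2, Real.sqrt_nonneg (1 + |r|)]
    have hAu : A ≤ A * Real.sqrt (1 + |r|) := le_mul_of_one_le_right hA0 hs1
    have hdiv : 0 ≤ C / (1 + |r|) ^ 2 := div_nonneg hC0 (pow_nonneg hu0.le 2)
    calc |hPlus r| * ‖testFunction c N v r‖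
        ≤ (A + Real.log (2 + |r|)) * (C / (1 + |r|) ^ 2) :=
          mul_le_mul hh hg (norm_nonneg _) (by linarith [abs_nonneg (hPlus r)])
      _ ≤ (A * Real.sqrt (1 + |r|) + 2 * Real.sqrt 2 * Real.sqrt (1 + |r|)) *
            (C / (1 + |r|) ^ 2) :=
          mul_le_mul_of_nonneg_right (add_le_add hAu hlog) hdiv
      _ = C * (A + 2 * Real.sqrt 2) * (Real.sqrt (1 + |r|) / (1 + |r|) ^ 2) := by ring

/-- **`⟨v, Q_arch,T v⟩ → (1/2π)∫_ℝ h₊(r) g_v(r) dr` as `T → ∞`** (Stage (A) and dominated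
convergence). [cite: Groskin2026, Theorem 2.5 proof (p. 6)] -/
theorem tendsto_quadValue_archMatrix {c : ℝ} (hc : 1 < c) (N : ℕ) (v : Fin (N + 1) → ℝ) :
    Tendsto (fun T : ℝ ↦ ((quadValue N v (archMatrix c N T) : ℝ) : ℂ)) atTop
      (𝓝 ((1 / (2 * π)) * ∫ r : ℝ, (hPlus r : ℂ) * testFunction c N v r)) := by
  have h := (MeasureTheory.intervalIntegral_tendsto_integral
    (integrable_hPlus_mul_testFunction hc N v) tendsto_neg_atTop_atBot tendsto_id).const_mul
    (1 / (2 * π) : ℂ)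
  refine Tendsto.congr (fun T ↦ ?_) h
  exact (quadValue_archMatrix hc N v T).symm

/-- `⟨v, (Q₁ + Q₂) v⟩ = ⟨v, Q₁ v⟩ + ⟨v, Q₂ v⟩`. [cite: Groskin2026, §2.1 eq. (4) (p. 4)] -/
theorem quadValue_add (N : ℕ) (v : Fin (N + 1) → ℝ) (Q₁ Q₂ : Matrix (idx N) (idx N) ℝ) :
    quadValue N v (Q₁ + Q₂) = quadValue N v Q₁ + quadValue N v Q₂ := by
  unfold quadValue
  rw [Matrix.add_mulVec, dotProduct_add]

/-- Under Lemma 2.1's limit clause, `⟨v, Q_arch,T v⟩ → ⟨v, Q_arch,∞ v⟩` (a finite sum of convergent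
entries). [cite: Groskin2026, Lemma 2.1 (p. 4); §2.1 eq. (4) (p. 4)] -/
theorem tendsto_quadValue_archMatrix_of_limit (h21 : lemma_2_1_limit) {c : ℝ} (hc : 1 < c)
    (N : ℕ) (v : Fin (N + 1) → ℝ) :
    Tendsto (fun T : ℝ ↦ quadValue N v (archMatrix c N T)) atTop
      (𝓝 (quadValue N v (archMatrixInfty c N))) := by
  simp only [quadValue_eq_sum']
  refine tendsto_finsetSum _ fun m _ ↦ tendsto_finsetSum _ fun n _ ↦ ?_
  exact (h21 c hc N m n).const_mul _

/-- **`⟨v, Q_arch,∞ v⟩ = (1/2π)∫_ℝ h₊(r) g_v(r) dr`** under Lemma 2.1's limit clause (uniqueness of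
limits). [cite: Groskin2026, Theorem 2.5 proof (p. 6)] -/
theorem quadValue_archMatrixInfty_of_limit (h21 : lemma_2_1_limit) {c : ℝ} (hc : 1 < c) (N : ℕ)
    (v : Fin (N + 1) → ℝ) :
    ((quadValue N v (archMatrixInfty c N) : ℝ) : ℂ) =
      (1 / (2 * π)) * ∫ r : ℝ, (hPlus r : ℂ) * testFunction c N v r := by
  have h1 : Tendsto (fun T : ℝ ↦ ((quadValue N v (archMatrix c N T) : ℝ) : ℂ)) atTop
      (𝓝 ((quadValue N v (archMatrixInfty c N) : ℝ) : ℂ)) :=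
    (Complex.continuous_ofReal.tendsto _).comp (tendsto_quadValue_archMatrix_of_limit h21 hc N v)
  exact tendsto_nhds_unique h1 (tendsto_quadValue_archMatrix hc N v)

/-- **[Gr26] Theorem 2.5, explicit-formula side, FROM Lemma 2.1's limit clause**: for `c > 1`,
`N ≥ 0` and every real `v`,
`⟨v, Q_∞ v⟩ = −(1/π)Σ_{q ≤ c} Λ(q) q^{−1/2} ĝ_v(log q/2π) + 2 g_v(i/2) + (1/2π)∫_ℝ h₊(r) g_v(r) dr`.
The door to the claim `theorem_2_5'`: its discharge is `theorem_2_5'_of lemma_2_1_limit_holds` once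
Lemma 2.1's limit clause is proved. [cite: Groskin2026, Theorem 2.5 (p. 6)] -/
theorem theorem_2_5'_of (h21 : lemma_2_1_limit) : theorem_2_5' := by
  intro c hc N v
  rw [cutoffFreeMatrix, quadValue_add, quadValue_add, Complex.ofReal_add, Complex.ofReal_add,
    quadValue_primeMatrix c hc N v, quadValue_poleMatrix c hc N v,
    quadValue_archMatrixInfty_of_limit h21 hc N v]

/-- **[Gr26] Theorem 2.5, explicit-formula (source) side — DISCHARGED**: for `c > 1`, `N ≥ 0` and
every real `v`,
`⟨v, Q_∞ v⟩ = −(1/π)Σ_{q ≤ c} Λ(q) q^{−1/2} ĝ_v(log q/2π) + 2 g_v(i/2) + (1/2π)∫_ℝ h₊(r) g_v(r) dr`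
(prime side and pole side: `TruncatedWeilFormSourceSideProofs`; archimedean side and `T → ∞`: this
file; entrywise limit: cc-t11 g4's `lemma_2_1_limit_holds`; decay: cc-t4 g5's `lemma_2_2_holds`
machinery). [claim: Groskin2026, status: under-review] [cite: Groskin2026, Theorem 2.5 (p. 6)] -/
theorem theorem_2_5'_holds : theorem_2_5' := theorem_2_5'_of lemma_2_1_limit_holds

end Groskin2026

end Literature.NumberTheory.LFunctions

end
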